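import Literature.Analysis.FluidPDE.PoissonVeryWeakInterior
import Literature.Analysis.FluidPDE.HolderLeibnizBounds
import Literature.Analysis.UnboundedOperators.HeatIteratedDerivBounds
import HarnessLib

/-!
# Jia–Šverák 2014, local higher regularity: tools of the derivative bootstrap

Analysis/FluidPDE proofs file (theorems only; no definitions, no named facts), part of the proof
of the named fact `Literature.Analysis.FluidPDE.jia_sverak_2014_local_higher_regularity`
(`JiaSverak2014LocalRegularity.lean`; H. Jia, V. Šverák, Invent. Math. 196 (2014) =
arXiv:1204.0529, §3 Thm 3.2 and the bootstrap remark after its proof, p. 9: "estimates for higher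
spatial derivatives (up to boundary `t = 0`) by bootstrap arguments" from the localised Duhamel
formula `u = ∫₀ᵗ e^{Δ(t-s)}[-div(u⊗uη) - ∇(pη)] ds + e^{Δt}(u₀η) + u₃`). Each level of the
bootstrap gains one spatial derivative on a smaller ball; this file provides the level-independent
tools:

* `iteratedFDeriv_integral_smul_comp_sub`, `newtonNearGradPotential_eq_integral_comp_sub`,
  `exists_newtonNear_level_bounds` — derivatives fall on the data of the near gradient potential
  `T⁰ₐ f = ∫ ∂ₐΓ₀(· - y) f(y) dy` (pressure term), and `T⁰ₐ` maps `C^{n,γ}` data to `C^{n+1,γ}`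
  with universal constants (Gilbarg–Trudinger Lemmas 4.2/4.4 of the tree on the top derivative);
* `caloric_level_bounds` — the caloric term `e^{tΔ}(χu₀)` keeps all derivative bounds of its data,
  uniformly in `t`;
* `integral_heatKernelFwd_sub`, `integrable_heatPotential_slice` — `L¹` contraction of the slices
  of a heat potential (size of the pressure potential `Q(t) = W₊⊛(χp)(t)` in `L¹`);
* `measurable_uncurry_heatKernel`, `measurable_heatKernelFwd_one`, `stronglyMeasurable_uncurry_duhamel`,
  `measurable_heatPotential` — joint measurability of slice Duhamel integrals and heat potentials;
* `norm_iteratedFDeriv_fderiv_apply_le`, `norm_iteratedFDeriv_fderiv_apply_sub_le` — directional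
  derivatives cost one order;
* `smooth_cutoff_datum` — a cut-off times a datum smooth on a ball is globally smooth with
  controlled derivatives;
* `component_level`, `exists_inner_data_bounds` — the inner data `χ ⟪R,v⟫⟪R,c⟫` of level `n` are
  `C^{n,γ}` with universal bounds (the tree's `HolderLeibniz.exists_leibniz_holder`).

## References

* H. Jia, V. Šverák, Invent. Math. 196 (2014) = arXiv:1204.0529, §3 (p. 9). Bib key
  `JiaSverak2014`.
* D. Gilbarg, N. S. Trudinger, *Elliptic Partial Differential Equations of Second Order* (2001),
  Lemmas 4.1, 4.2, 4.4. Bib key `GilbargTrudinger2001`.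
-/

noncomputable section

open MeasureTheory Set Function Filter Metric InnerProductSpace TopologicalSpace
open _root_.Topology
open scoped ENNReal NNReal ContDiff Laplacian

namespace Literature.Analysis.FluidPDE

namespace JiaSverak2014

-- nested operator types
set_option maxSynthPendingDepth 3

variable {r₀ r₁ : ℝ}

/-! ## Derivatives fall on the data of kernel-side potentials `∫ k(z) • g(x - z) dz` -/

/-- **Iterated derivatives fall on `Cⁿ` data**: for `k ∈ L¹` vanishing off a ball and `g ∈ Cⁿ`,
for `m ≤ n`,
`Dᵐ(∫ k(z) • g(· - z) dz) = ∫ k(z) • Dᵐg(· - z) dz` (induction, the tree's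
`fderiv_integral_smul_comp_sub`, and the commutation of the `z`-integral with the currying
isometry). [folklore] -/
theorem iteratedFDeriv_integral_smul_comp_sub {F : Type} [NormedAddCommGroup F] [NormedSpace ℝ F] [CompleteSpace F]
    {k : (EuclideanSpace ℝ (Fin 3)) → ℝ} {ρ : ℝ} (hk : Integrable k) (hkρ : ∀ z, ρ < ‖z‖ → k z = 0)
    {n : ℕ} {g : (EuclideanSpace ℝ (Fin 3)) → F} (hg : ContDiff ℝ n g) :
    ∀ m ≤ n, iteratedFDeriv ℝ m (fun x => ∫ z, k z • g (x - z)) =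
      fun x => ∫ z, k z • iteratedFDeriv ℝ m g (x - z) := by
  intro m
  induction m with
  | zero =>
    intro _
    funext x
    ext v
    rw [iteratedFDeriv_zero_apply]
    set L : F →L[ℝ] (EuclideanSpace ℝ (Fin 3)) [×0]→L[ℝ] F :=
      ((continuousMultilinearCurryFin0 ℝ (EuclideanSpace ℝ (Fin 3)) F).symm : F →L[ℝ] (EuclideanSpace ℝ (Fin 3)) [×0]→L[ℝ] F) with hL
    have hint : Integrable (fun z => k z • g (x - z)) := integrable_smul_comp_sub hk hkρ hg.continuous x
    have e1 : (∫ z, k z • iteratedFDeriv ℝ 0 g (x - z)) = ∫ z, L (k z • g (x - z)) := by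
      refine integral_congr_ae (Eventually.of_forall fun z => ?_)
      rw [iteratedFDeriv_zero_eq_comp]
      simp only [Function.comp_apply]
      rw [map_smul]
      rfl
    rw [e1, L.integral_comp_comm hint]
    simp [hL]
  | succ m ih =>
    intro hm
    have hm' : m ≤ n := (Nat.le_succ m).trans hm
    have hfun := ih hm'
    set G : (EuclideanSpace ℝ (Fin 3)) → (EuclideanSpace ℝ (Fin 3)) [×m]→L[ℝ] F := iteratedFDeriv ℝ m g with hG
    have hG1 : ContDiff ℝ 1 G := by
      have hm1 : 1 + m ≤ n := by omega
      exact hg.iteratedFDeriv_right (i := m) (m := 1) (by exact_mod_cast hm1)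
    set L : ((EuclideanSpace ℝ (Fin 3)) →L[ℝ] (EuclideanSpace ℝ (Fin 3)) [×m]→L[ℝ] F) →L[ℝ]
        (EuclideanSpace ℝ (Fin 3)) [×(m + 1)]→L[ℝ] F :=
      ((continuousMultilinearCurryLeftEquiv ℝ (fun _ : Fin (m + 1) => (EuclideanSpace ℝ (Fin 3))) F).symm.toContinuousLinearEquiv :
        ((EuclideanSpace ℝ (Fin 3)) →L[ℝ] (EuclideanSpace ℝ (Fin 3)) [×m]→L[ℝ] F) →L[ℝ] (EuclideanSpace ℝ (Fin 3)) [×(m + 1)]→L[ℝ] F)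
      with hL
    funext x
    rw [iteratedFDeriv_succ_eq_comp_left, Function.comp_apply, hfun,
      show (fun x => ∫ z, k z • iteratedFDeriv ℝ m g (x - z)) = fun x => ∫ z, k z • G (x - z) from rfl,
      fderiv_integral_smul_comp_sub hk hkρ hG1 x]
    have hint : Integrable (fun z => k z • fderiv ℝ G (x - z)) :=
      integrable_smul_comp_sub hk hkρ (hG1.continuous_fderiv one_ne_zero) x
    have e1 : (∫ z, k z • iteratedFDeriv ℝ (m + 1) g (x - z)) = ∫ z, L (k z • fderiv ℝ G (x - z)) := by
      refine integral_congr_ae (Eventually.of_forall fun z => ?_)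
      rw [iteratedFDeriv_succ_eq_comp_left]
      simp only [Function.comp_apply]
      rw [map_smul]
      rfl
    rw [e1, L.integral_comp_comm hint]
    rfl

/-- `T⁰ₐ g` in kernel-side form: `T⁰ₐ g (x) = ∫ ∂ₐΓ₀(z) • g(x - z) dz`. [folklore] -/
theorem newtonNearGradPotential_eq_integral_comp_sub {F : Type*} [NormedAddCommGroup F] [NormedSpace ℝ F]
    (r₀ r₁ : ℝ) (a : EuclideanSpace ℝ (Fin 3)) (g : (EuclideanSpace ℝ (Fin 3)) → F) :
    newtonNearGradPotential r₀ r₁ a g = fun x => ∫ z, newtonNearGrad r₀ r₁ a z • g (x - z) := by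
  funext x
  rw [newtonNearGradPotential]
  have e := integral_sub_left_eq_self (fun y => newtonNearGrad r₀ r₁ a (x - y) • g y) x (μ := volume)
  simp only [sub_sub_cancel] at e
  rw [← e]

/-- **Level bounds for the near gradient potential** `T⁰ₐ f = ∫ ∂ₐΓ₀(· - y) f(y) dy` of real
`C^{n,γ}` data: for `n`, `0 < γ < 1` and radii `0 < r₀ < r₁` there is `C` with: if `f ∈ Cⁿ(ℝ³; ℝ)`
has `‖Dᵏf‖ ≤ M` (`k ≤ n`) and `‖Dⁿf(y) - Dⁿf(z)‖ ≤ M‖y - z‖^γ`, then `T⁰ₐf ∈ C^{n+1}` with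
`‖Dᵏ(T⁰ₐf)‖ ≤ C ‖a‖ M` (`k ≤ n + 1`) and `[Dⁿ⁺¹(T⁰ₐf)]_γ ≤ C ‖a‖ M` (derivatives on the data
up to order `n`, then Gilbarg–Trudinger's Lemma 4.2/4.4 bounds of the tree,
`exists_newtonNearGradPotentialDeriv_bounds`, on the Hölder data `Dⁿf`).
[cite: GilbargTrudinger2001, Lemmas 4.2 and 4.4] -/
theorem exists_newtonNear_level_bounds (n : ℕ) {γ : ℝ} (hγ0 : 0 < γ) (hγ1 : γ < 1) (h₀ : 0 < r₀) (h₁ : r₀ < r₁) :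
    ∃ C : ℝ, 0 ≤ C ∧ ∀ {f : (EuclideanSpace ℝ (Fin 3)) → ℝ} {M : ℝ}, 0 ≤ M → ContDiff ℝ n f →
      (∀ k ≤ n, ∀ y, ‖iteratedFDeriv ℝ k f y‖ ≤ M) →
      (∀ y z, ‖iteratedFDeriv ℝ n f y - iteratedFDeriv ℝ n f z‖ ≤ M * ‖y - z‖ ^ γ) →
      ∀ a : EuclideanSpace ℝ (Fin 3),
        ContDiff ℝ (n + 1) (newtonNearGradPotential r₀ r₁ a f) ∧
        (∀ k ≤ n + 1, ∀ x, ‖iteratedFDeriv ℝ k (newtonNearGradPotential r₀ r₁ a f) x‖ ≤ C * ‖a‖ * M) ∧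
        ∀ x y, ‖iteratedFDeriv ℝ (n + 1) (newtonNearGradPotential r₀ r₁ a f) x -
          iteratedFDeriv ℝ (n + 1) (newtonNearGradPotential r₀ r₁ a f) y‖ ≤ C * ‖a‖ * M * ‖x - y‖ ^ γ := by
  obtain ⟨C₁, hC₁0, hC₁⟩ := exists_abs_newtonNearGrad_le h₀ h₁
  obtain ⟨Cn, hCn0, hCn⟩ := exists_newtonNearGradPotentialDeriv_bounds
    (F := (EuclideanSpace ℝ (Fin 3)) [×n]→L[ℝ] ℝ) h₀ h₁
  set V : ℝ := 3 * (volume : Measure (EuclideanSpace ℝ (Fin 3))).real (ball 0 1) with hV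
  have hV0 : 0 ≤ V := by rw [hV]; positivity
  have hr₁ : 0 < r₁ := h₀.trans h₁
  have h1γ : 0 < 1 - γ := by linarith
  set γ' : ℝ≥0 := ⟨γ, hγ0.le⟩ with hγ'
  have hγ'0 : 0 < γ' := by exact_mod_cast hγ0
  have hγ'1 : γ' < 1 := by exact_mod_cast hγ1
  have hγ'c : ((γ' : ℝ≥0) : ℝ) = γ := rfl
  set C : ℝ := C₁ * V * r₁ + Cn * (r₁ ^ γ / γ) + Cn * (1 / γ + 1 / (1 - γ) + 1) with hCdef
  have hC0 : 0 ≤ C := by positivity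
  refine ⟨C, hC0, ?_⟩
  intro f M hM hf hfb hfH a
  -- the kernel
  have hk : Integrable (newtonNearGrad r₀ r₁ a) := integrable_newtonNearGrad h₀ h₁ a
  have hkρ : ∀ z : EuclideanSpace ℝ (Fin 3), r₁ < ‖z‖ → newtonNearGrad r₀ r₁ a z = 0 := fun z hz =>
    newtonNearGrad_eq_zero_of_lt h₀.le h₁ a hz
  set T : (EuclideanSpace ℝ (Fin 3)) → ℝ := newtonNearGradPotential r₀ r₁ a f with hT
  have hTk : T = fun x => ∫ z, newtonNearGrad r₀ r₁ a z • f (x - z) := newtonNearGradPotential_eq_integral_comp_sub r₀ r₁ a f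
  -- derivatives on the data, `k ≤ n`
  have hDk : ∀ k ≤ n, iteratedFDeriv ℝ k T = newtonNearGradPotential r₀ r₁ a (iteratedFDeriv ℝ k f) := by
    intro k hk'
    rw [hTk, iteratedFDeriv_integral_smul_comp_sub hk hkρ hf k hk', newtonNearGradPotential_eq_integral_comp_sub]
  -- the top data `Dⁿf` and its potential
  set G : (EuclideanSpace ℝ (Fin 3)) → (EuclideanSpace ℝ (Fin 3)) [×n]→L[ℝ] ℝ := iteratedFDeriv ℝ n f with hG
  have hGH : HolderWith (Real.toNNReal M) γ' G := by
    refine Literature.Analysis.FunctionSpaces.holderWith_of_dist_le fun y z => ?_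
    rw [dist_eq_norm, dist_eq_norm, hγ'c, Real.coe_toNNReal M hM]
    exact hfH y z
  set Tn : (EuclideanSpace ℝ (Fin 3)) → (EuclideanSpace ℝ (Fin 3)) [×n]→L[ℝ] ℝ := newtonNearGradPotential r₀ r₁ a G with hTn
  have hDn : iteratedFDeriv ℝ n T = Tn := hDk n le_rfl
  have hTn1 : ∀ x, HasFDerivAt Tn (newtonNearGradPotentialDeriv r₀ r₁ a G x) x := fun x =>
    hasFDerivAt_newtonNearGradPotential h₀ h₁ a hGH hγ'0 hγ'1 x
  have hbd := hCn a G (Real.toNNReal M) γ' hGH hγ'0 hγ'1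
  rw [Real.coe_toNNReal M hM, hγ'c] at hbd
  set L₁ := (continuousMultilinearCurryLeftEquiv ℝ (fun _ : Fin (n + 1) => (EuclideanSpace ℝ (Fin 3))) ℝ).symm with hL₁
  have hDn1 : ∀ x, iteratedFDeriv ℝ (n + 1) T x = L₁ (newtonNearGradPotentialDeriv r₀ r₁ a G x) := by
    intro x
    rw [iteratedFDeriv_succ_eq_comp_left, Function.comp_apply, hDn, (hTn1 x).fderiv]
  /- ### bounds -/
  have Bk : ∀ k ≤ n, ∀ x, ‖iteratedFDeriv ℝ k T x‖ ≤ C₁ * V * r₁ * ‖a‖ * M := by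
    intro k hk' x
    rw [hDk k hk']
    have h := norm_newtonNearGradPotential_le (F := (EuclideanSpace ℝ (Fin 3)) [×k]→L[ℝ] ℝ) h₀ h₁ hC₁0 hC₁ a hM
      (fun y => hfb k hk' y) x
    calc _ ≤ C₁ * ‖a‖ * M * (3 * (volume : Measure (EuclideanSpace ℝ (Fin 3))).real (ball 0 1)) * r₁ := h
      _ = C₁ * V * r₁ * ‖a‖ * M := by rw [hV]; ring
  have Bn1 : ∀ x, ‖iteratedFDeriv ℝ (n + 1) T x‖ ≤ Cn * (r₁ ^ γ / γ) * ‖a‖ * M := by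
    intro x
    rw [hDn1 x, LinearIsometryEquiv.norm_map]
    calc _ ≤ Cn * ‖a‖ * M * (r₁ ^ γ / γ) := hbd.1 x
      _ = Cn * (r₁ ^ γ / γ) * ‖a‖ * M := by ring
  have Hn1 : ∀ x y, ‖iteratedFDeriv ℝ (n + 1) T x - iteratedFDeriv ℝ (n + 1) T y‖ ≤
      Cn * (1 / γ + 1 / (1 - γ) + 1) * ‖a‖ * M * ‖x - y‖ ^ γ := by
    intro x y
    rw [hDn1 x, hDn1 y, ← map_sub, LinearIsometryEquiv.norm_map]
    calc _ ≤ Cn * ‖a‖ * M * (1 / γ + 1 / (1 - γ) + 1) * ‖x - y‖ ^ γ := hbd.2 x y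
      _ = Cn * (1 / γ + 1 / (1 - γ) + 1) * ‖a‖ * M * ‖x - y‖ ^ γ := by ring
  /- ### smoothness -/
  have hsmooth : ContDiff ℝ ((n + 1 : ℕ) : ℕ∞) T := by
    refine contDiff_iff_continuous_differentiable.2 ⟨fun m hm => ?_, fun m hm => ?_⟩
    · have hm' : m ≤ n + 1 := by exact_mod_cast hm
      rcases Nat.lt_or_ge m (n + 1) with hlt | hge
      · rcases Nat.lt_or_ge m n with hlt' | hge'
        · have hmn : m ≤ n := hlt'.le
          rw [hDk m hmn, newtonNearGradPotential_eq_integral_comp_sub]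
          have hc1 : ContDiff ℝ 1 (iteratedFDeriv ℝ m f) :=
            hf.iteratedFDeriv_right (i := m) (m := 1) (by exact_mod_cast (show 1 + m ≤ n by omega))
          exact (contDiff_integral_smul_comp_sub hk hkρ 1 hc1).continuous
        · have hmn : m = n := by omega
          subst hmn
          rw [hDn]
          exact continuous_iff_continuousAt.2 fun x => (hTn1 x).continuousAt
      · have hm1 : m = n + 1 := by omega
        subst hm1
        have hHc : 0 ≤ Cn * (1 / γ + 1 / (1 - γ) + 1) * ‖a‖ * M := by positivity
        refine continuous_iff_continuousAt.2 fun x => ?_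
        rw [ContinuousAt, tendsto_iff_norm_sub_tendsto_zero]
        have hlim : Tendsto (fun y => Cn * (1 / γ + 1 / (1 - γ) + 1) * ‖a‖ * M * ‖y - x‖ ^ γ) (𝓝 x) (𝓝 0) := by
          have h1 : Tendsto (fun y : EuclideanSpace ℝ (Fin 3) => ‖y - x‖) (𝓝 x) (𝓝 0) := by
            have hc' : Continuous fun y : EuclideanSpace ℝ (Fin 3) => ‖y - x‖ := (continuous_id.sub continuous_const).norm
            have h := hc'.tendsto x
            simp only [sub_self, norm_zero] at h
            exact h
          have h2 : Tendsto (fun y : EuclideanSpace ℝ (Fin 3) => ‖y - x‖ ^ γ) (𝓝 x) (𝓝 0) := by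
            have := h1.rpow_const (p := γ) (Or.inr hγ0.le)
            rwa [Real.zero_rpow hγ0.ne'] at this
          simpa using h2.const_mul (Cn * (1 / γ + 1 / (1 - γ) + 1) * ‖a‖ * M)
        refine squeeze_zero (fun y => norm_nonneg _) (fun y => ?_) hlim
        exact Hn1 y x
    · have hm' : m < n + 1 := by exact_mod_cast hm
      rcases Nat.lt_or_ge m n with hlt' | hge'
      · have hmn : m ≤ n := hlt'.le
        rw [hDk m hmn, newtonNearGradPotential_eq_integral_comp_sub]
        have hc1 : ContDiff ℝ 1 (iteratedFDeriv ℝ m f) :=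
          hf.iteratedFDeriv_right (i := m) (m := 1) (by exact_mod_cast (show 1 + m ≤ n by omega))
        exact (contDiff_integral_smul_comp_sub hk hkρ 1 hc1).differentiable one_ne_zero
      · have hmn : m = n := by omega
        subst hmn
        rw [hDn]
        exact fun x => (hTn1 x).differentiableAt
  have haM : 0 ≤ ‖a‖ * M := by positivity
  refine ⟨by exact_mod_cast hsmooth, fun k hk' x => ?_, fun x y => ?_⟩
  · rcases Nat.lt_or_ge k (n + 1) with hlt | hge
    · calc ‖iteratedFDeriv ℝ k T x‖ ≤ C₁ * V * r₁ * ‖a‖ * M := Bk k (by omega) x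
        _ = (C₁ * V * r₁) * (‖a‖ * M) := by ring
        _ ≤ C * (‖a‖ * M) := by
            refine mul_le_mul_of_nonneg_right ?_ haM
            rw [hCdef]
            have : 0 ≤ Cn * (r₁ ^ γ / γ) + Cn * (1 / γ + 1 / (1 - γ) + 1) := by positivity
            linarith
        _ = C * ‖a‖ * M := by ring
    · have hk1 : k = n + 1 := by omega
      subst hk1
      calc ‖iteratedFDeriv ℝ (n + 1) T x‖ ≤ Cn * (r₁ ^ γ / γ) * ‖a‖ * M := Bn1 x
        _ = (Cn * (r₁ ^ γ / γ)) * (‖a‖ * M) := by ring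
        _ ≤ C * (‖a‖ * M) := by
            refine mul_le_mul_of_nonneg_right ?_ haM
            rw [hCdef]
            have h1 : 0 ≤ C₁ * V * r₁ := by positivity
            have h2 : 0 ≤ Cn * (1 / γ + 1 / (1 - γ) + 1) := by positivity
            linarith
        _ = C * ‖a‖ * M := by ring
  · calc _ ≤ Cn * (1 / γ + 1 / (1 - γ) + 1) * ‖a‖ * M * ‖x - y‖ ^ γ := Hn1 x y
      _ = (Cn * (1 / γ + 1 / (1 - γ) + 1)) * (‖a‖ * M * ‖x - y‖ ^ γ) := by ring
      _ ≤ C * (‖a‖ * M * ‖x - y‖ ^ γ) := by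
          refine mul_le_mul_of_nonneg_right ?_ (by positivity)
          rw [hCdef]
          have h1 : 0 ≤ C₁ * V * r₁ := by positivity
          have h2 : 0 ≤ Cn * (r₁ ^ γ / γ) := by positivity
          linarith
      _ = C * ‖a‖ * M * ‖x - y‖ ^ γ := by ring

/-! ## The caloric term: all-order bounds, uniformly in time -/

/-- **Level bounds for the caloric extension of smooth data with bounded derivatives.** For
`g ∈ C^∞` with `‖Dᵐg‖ ≤ B m` for all `m`, and every `t`, the function `x ↦ e^{tΔ}g(x)` (`t > 0`;
`g` itself for `t ≤ 0`) is `C^m` for every `m`, with `‖Dᵐ‖ ≤ B m` and `Dᵐ` `B(m+1)`-Lipschitz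
(derivatives fall on the data and the heat kernel has mass one,
`norm_iteratedFDeriv_heatExtension_le_of_bounded`). [folklore] -/
theorem caloric_level_bounds {F : Type} [NormedAddCommGroup F] [NormedSpace ℝ F] [CompleteSpace F]
    {g : (EuclideanSpace ℝ (Fin 3)) → F} (hg : ∀ m : ℕ, ContDiff ℝ m g) {B : ℕ → ℝ}
    (hB : ∀ m x, ‖iteratedFDeriv ℝ m g x‖ ≤ B m) (t : ℝ) :
    (∀ m : ℕ, ContDiff ℝ m (fun x => if 0 < t then UnboundedOperators.heatExtension g t x else g x)) ∧
    (∀ m x, ‖iteratedFDeriv ℝ m (fun x => if 0 < t then UnboundedOperators.heatExtension g t x else g x) x‖ ≤ B m) ∧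
    ∀ m x y, ‖iteratedFDeriv ℝ m (fun x => if 0 < t then UnboundedOperators.heatExtension g t x else g x) x -
      iteratedFDeriv ℝ m (fun x => if 0 < t then UnboundedOperators.heatExtension g t x else g x) y‖ ≤ B (m + 1) * ‖x - y‖ := by
  have hB0 : ∀ z, ‖g z‖ ≤ B 0 := fun z => by simpa using hB 0 z
  -- the two cases define the same kind of object: a `C^∞` function with `‖Dᵐ‖ ≤ B m`
  have key : ∀ (h : (EuclideanSpace ℝ (Fin 3)) → F), (∀ m : ℕ, ContDiff ℝ m h) → (∀ m x, ‖iteratedFDeriv ℝ m h x‖ ≤ B m) →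
      ∀ m x y, ‖iteratedFDeriv ℝ m h x - iteratedFDeriv ℝ m h y‖ ≤ B (m + 1) * ‖x - y‖ := by
    intro h hh hhB m x y
    have hd : Differentiable ℝ (iteratedFDeriv ℝ m h) :=
      (hh (m + 1)).differentiable_iteratedFDeriv (by exact_mod_cast Nat.lt_succ_self m)
    exact Convex.norm_image_sub_le_of_norm_fderiv_le (fun z _ => hd z)
      (fun z _ => by rw [norm_fderiv_iteratedFDeriv]; exact hhB (m + 1) z) convex_univ (mem_univ y) (mem_univ x)
  by_cases ht : 0 < t
  · simp only [ht, if_true]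
    have hsm : ∀ m : ℕ, ContDiff ℝ m (UnboundedOperators.heatExtension g t) := fun m =>
      UnboundedOperators.contDiff_heatExtension_of_bound (hg 0).continuous hB0 ht
    have hbd : ∀ m x, ‖iteratedFDeriv ℝ m (UnboundedOperators.heatExtension g t) x‖ ≤ B m := fun m x =>
      UnboundedOperators.norm_iteratedFDeriv_heatExtension_le_of_bounded (hg m) (fun j _ z => hB j z) ht le_rfl x
    exact ⟨hsm, hbd, key _ hsm hbd⟩
  · simp only [ht, if_false]
    exact ⟨hg, hB, key _ hg hB⟩

/-! ## `L¹` contraction of the slices of a heat potential -/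

/-- The heat kernel is jointly measurable in `(t, x)` (also at `t ≤ 0`, where it is a junk value).
[folklore] -/
theorem measurable_uncurry_heatKernel :
    Measurable fun q : ℝ × EuclideanSpace ℝ (Fin 3) => UnboundedOperators.heatKernel q.1 q.2 := by
  unfold UnboundedOperators.heatKernel
  fun_prop

/-- The forward heat kernel is measurable on `ℝ × ℝ³`. [folklore] -/
theorem measurable_heatKernelFwd_one : Measurable (heatKernelFwd 1 : ℝ × EuclideanSpace ℝ (Fin 3) → ℝ) := by
  have h1 : Measurable fun w : ℝ × EuclideanSpace ℝ (Fin 3) => UnboundedOperators.heatKernel (1 * w.1) w.2 :=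
    measurable_uncurry_heatKernel.comp ((measurable_const.mul measurable_fst).prodMk measurable_snd)
  refine Measurable.ite (measurableSet_lt measurable_const measurable_fst) h1 measurable_const

/-- The `x`-integral of the forward heat kernel: `∫ W₊(τ, x - y) dx = 1` for `τ > 0`, `0` else.
[folklore] -/
theorem integral_heatKernelFwd_sub (τ : ℝ) (y : EuclideanSpace ℝ (Fin 3)) :
    ∫ x : EuclideanSpace ℝ (Fin 3), heatKernelFwd 1 (τ, x - y) = if 0 < τ then 1 else 0 := by
  by_cases hτ : 0 < τ
  · rw [if_pos hτ]
    have e : (fun x : EuclideanSpace ℝ (Fin 3) => heatKernelFwd 1 (τ, x - y)) =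
        fun x => UnboundedOperators.heatKernel τ (x - y) := by
      funext x; rw [heatKernelFwd_of_pos 1 (by exact hτ)]; simp
    rw [e, integral_sub_right_eq_self (UnboundedOperators.heatKernel (E := EuclideanSpace ℝ (Fin 3)) τ) y,
      UnboundedOperators.integral_heatKernel_eq_one_holds hτ]
  · rw [if_neg hτ]
    have e : (fun x : EuclideanSpace ℝ (Fin 3) => heatKernelFwd 1 (τ, x - y)) = fun _ => 0 := by
      funext x; exact heatKernelFwd_of_nonpos 1 (not_lt.1 hτ)
    rw [e, integral_zero]

/-- **`L¹` contraction**: for integrable real data `D` on `ℝ × ℝ³`, every slice of the heat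
potential is integrable with `∫ |W₊⊛D(t, x)| dx ≤ ∫∫ |D|`. [folklore] -/
theorem integrable_heatPotential_slice {D : ℝ × (EuclideanSpace ℝ (Fin 3)) → ℝ} (hDm : Measurable D)
    (hDi : Integrable D volume) (t : ℝ) :
    Integrable (fun x : EuclideanSpace ℝ (Fin 3) => heatPotential 1 D (t, x)) volume ∧
      ∫ x : EuclideanSpace ℝ (Fin 3), ‖heatPotential 1 D (t, x)‖ ≤ ∫ w, ‖D w‖ := by
  -- the integrand on `ℝ³ × (ℝ × ℝ³)`
  set Φ : (EuclideanSpace ℝ (Fin 3)) × (ℝ × EuclideanSpace ℝ (Fin 3)) → ℝ :=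
    fun q => heatKernelFwd 1 ((t, q.1) - q.2) * D q.2 with hΦ
  have hKm : Measurable fun q : (EuclideanSpace ℝ (Fin 3)) × (ℝ × EuclideanSpace ℝ (Fin 3)) => heatKernelFwd 1 ((t, q.1) - q.2) := by
    exact measurable_heatKernelFwd_one.comp ((measurable_const.prodMk measurable_fst).sub measurable_snd)
  have hΦm : Measurable Φ := hKm.mul (hDm.comp measurable_snd)
  have hK0 : ∀ q : (EuclideanSpace ℝ (Fin 3)) × (ℝ × EuclideanSpace ℝ (Fin 3)), 0 ≤ heatKernelFwd 1 ((t, q.1) - q.2) := fun q => by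
    unfold heatKernelFwd
    split_ifs with h
    · exact (UnboundedOperators.heatKernel_pos (by simpa using h) _).le
    · exact le_rfl
  -- `∫_x W₊((t,x) - w) dx ≤ 1`
  have hxint : ∀ w : ℝ × EuclideanSpace ℝ (Fin 3), ∫ x : EuclideanSpace ℝ (Fin 3), heatKernelFwd 1 ((t, x) - w) ≤ 1 := by
    intro w
    have e : (fun x : EuclideanSpace ℝ (Fin 3) => heatKernelFwd 1 ((t, x) - w)) = fun x => heatKernelFwd 1 (t - w.1, x - w.2) := by
      funext x; rfl
    rw [e, integral_heatKernelFwd_sub]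
    split_ifs <;> norm_num
  have hxInt : ∀ w : ℝ × EuclideanSpace ℝ (Fin 3), Integrable (fun x : EuclideanSpace ℝ (Fin 3) => heatKernelFwd 1 ((t, x) - w)) := by
    intro w
    by_cases hτ : 0 < t - w.1
    · have e : (fun x : EuclideanSpace ℝ (Fin 3) => heatKernelFwd 1 ((t, x) - w)) =
          fun x => UnboundedOperators.heatKernel (t - w.1) (x - w.2) := by
        funext x
        have : ((t, x) - w : ℝ × EuclideanSpace ℝ (Fin 3)) = (t - w.1, x - w.2) := rfl
        rw [this, heatKernelFwd_of_pos 1 (by exact hτ)]; simp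
      rw [e]; exact (UnboundedOperators.integrable_heatKernel_holds hτ).comp_sub_right w.2
    · have e : (fun x : EuclideanSpace ℝ (Fin 3) => heatKernelFwd 1 ((t, x) - w)) = fun _ => 0 := by
        funext x
        have : ((t, x) - w : ℝ × EuclideanSpace ℝ (Fin 3)) = (t - w.1, x - w.2) := rfl
        rw [this]; exact heatKernelFwd_of_nonpos 1 (not_lt.1 hτ)
      rw [e]; exact integrable_zero _ _ _
  -- integrability on the product (sections in `x` first)
  have hint : Integrable Φ ((volume : Measure (EuclideanSpace ℝ (Fin 3))).prod volume) := by
    rw [integrable_prod_iff' hΦm.aestronglyMeasurable]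
    refine ⟨Eventually.of_forall fun w => ?_, ?_⟩
    · simp only [hΦ]
      exact (hxInt w).mul_const _
    · refine (hDi.norm).mono' ?_ (Eventually.of_forall fun w => ?_)
      · exact (hΦm.norm.stronglyMeasurable.integral_prod_left' (μ := (volume : Measure (EuclideanSpace ℝ (Fin 3))))).aestronglyMeasurable
      · rw [Real.norm_of_nonneg (integral_nonneg fun x => norm_nonneg _)]
        simp only [hΦ, norm_mul, Real.norm_eq_abs]
        have e : (fun x : EuclideanSpace ℝ (Fin 3) => |heatKernelFwd 1 ((t, x) - w)| * |D w|) =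
            fun x => heatKernelFwd 1 ((t, x) - w) * |D w| := by
          funext x; rw [abs_of_nonneg (hK0 (x, w))]
        rw [e, integral_mul_const]
        calc (∫ x : EuclideanSpace ℝ (Fin 3), heatKernelFwd 1 ((t, x) - w)) * |D w| ≤ 1 * |D w| :=
              mul_le_mul_of_nonneg_right (hxint w) (abs_nonneg _)
          _ = ‖D w‖ := by rw [one_mul, Real.norm_eq_abs]
  have hslice : ∀ x : EuclideanSpace ℝ (Fin 3), heatPotential 1 D (t, x) = ∫ w, Φ (x, w) := by
    intro x; simp only [heatPotential, smul_eq_mul, hΦ]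
  have hslice' : (fun x : EuclideanSpace ℝ (Fin 3) => heatPotential 1 D (t, x)) = fun x => ∫ w, Φ (x, w) := funext hslice
  refine ⟨by rw [hslice']; exact hint.integral_prod_left, ?_⟩
  simp_rw [hslice]
  calc ∫ x : EuclideanSpace ℝ (Fin 3), ‖∫ w, Φ (x, w)‖ ≤ ∫ x : EuclideanSpace ℝ (Fin 3), ∫ w, ‖Φ (x, w)‖ :=
        integral_mono_of_nonneg (Eventually.of_forall fun x => norm_nonneg _) hint.norm.integral_prod_left
          (Eventually.of_forall fun x => norm_integral_le_integral_norm _)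
    _ = ∫ w, ∫ x : EuclideanSpace ℝ (Fin 3), ‖Φ (x, w)‖ := integral_integral_swap hint.norm
    _ ≤ ∫ w, ‖D w‖ := by
        refine integral_mono_of_nonneg (Eventually.of_forall fun w => integral_nonneg fun x => norm_nonneg _) hDi.norm
          (Eventually.of_forall fun w => ?_)
        simp only [hΦ, norm_mul, Real.norm_eq_abs]
        have e : (fun x : EuclideanSpace ℝ (Fin 3) => |heatKernelFwd 1 ((t, x) - w)| * |D w|) =
            fun x => heatKernelFwd 1 ((t, x) - w) * |D w| := by
          funext x; rw [abs_of_nonneg (hK0 (x, w))]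
        rw [e, integral_mul_const]
        calc (∫ x : EuclideanSpace ℝ (Fin 3), heatKernelFwd 1 ((t, x) - w)) * |D w| ≤ 1 * |D w| :=
              mul_le_mul_of_nonneg_right (hxint w) (abs_nonneg _)
          _ = |D w| := one_mul _

/-! ## Joint measurability of slice Duhamel integrals -/

/-- **Joint measurability of the slice Duhamel integral**: for a jointly measurable real family
`g : ℝ → ℝ³ → ℝ`, the function `(t, x) ↦ ∫_{(0,t)} e^{(t-s)Δ}g(s)(x) ds` is strongly measurable.
[folklore] -/
theorem stronglyMeasurable_uncurry_duhamel {g : ℝ → (EuclideanSpace ℝ (Fin 3)) → ℝ}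
    (hgm : Measurable (uncurry g)) :
    StronglyMeasurable (uncurry fun t x => ∫ s in Ioo 0 t, UnboundedOperators.heatExtension (g s) (t - s) x) := by
  -- the caloric extension as a jointly measurable function of `((t, x), s)`
  have hH : Measurable fun q : (ℝ × EuclideanSpace ℝ (Fin 3)) × ℝ =>
      UnboundedOperators.heatExtension (g q.2) (q.1.1 - q.2) q.1.2 := by
    have e : (fun q : (ℝ × EuclideanSpace ℝ (Fin 3)) × ℝ => UnboundedOperators.heatExtension (g q.2) (q.1.1 - q.2) q.1.2) =
        fun q => ∫ y, UnboundedOperators.heatKernel (q.1.1 - q.2) y • g q.2 (q.1.2 - y) := by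
      funext q; rw [UnboundedOperators.heatExtension_apply]
    rw [e]
    have hI : Measurable fun p : ((ℝ × EuclideanSpace ℝ (Fin 3)) × ℝ) × EuclideanSpace ℝ (Fin 3) =>
        UnboundedOperators.heatKernel (p.1.1.1 - p.1.2) p.2 • g p.1.2 (p.1.1.2 - p.2) := by
      have hA : Measurable fun p : ((ℝ × EuclideanSpace ℝ (Fin 3)) × ℝ) × EuclideanSpace ℝ (Fin 3) =>
          UnboundedOperators.heatKernel (p.1.1.1 - p.1.2) p.2 :=
        measurable_uncurry_heatKernel.comp ((measurable_fst.fst.fst.sub measurable_fst.snd).prodMk measurable_snd)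
      have hB : Measurable fun p : ((ℝ × EuclideanSpace ℝ (Fin 3)) × ℝ) × EuclideanSpace ℝ (Fin 3) => g p.1.2 (p.1.1.2 - p.2) := by
        have : (fun p : ((ℝ × EuclideanSpace ℝ (Fin 3)) × ℝ) × EuclideanSpace ℝ (Fin 3) => g p.1.2 (p.1.1.2 - p.2)) =
            uncurry g ∘ fun p => (p.1.2, p.1.1.2 - p.2) := rfl
        rw [this]
        exact hgm.comp (measurable_fst.snd.prodMk (measurable_fst.fst.snd.sub measurable_snd))
      exact hA.smul hB
    exact (hI.stronglyMeasurable.integral_prod_right' :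
      StronglyMeasurable fun q : (ℝ × EuclideanSpace ℝ (Fin 3)) × ℝ => ∫ y : EuclideanSpace ℝ (Fin 3),
        UnboundedOperators.heatKernel (q.1.1 - q.2) y • g q.2 (q.1.2 - y)).measurable
  -- the time cut `0 < s < t`
  have hS : MeasurableSet {q : (ℝ × EuclideanSpace ℝ (Fin 3)) × ℝ | q.2 ∈ Ioo 0 q.1.1} := by
    have : {q : (ℝ × EuclideanSpace ℝ (Fin 3)) × ℝ | q.2 ∈ Ioo 0 q.1.1} = {q | 0 < q.2} ∩ {q | q.2 < q.1.1} := by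
      ext q; simp [mem_Ioo]
    rw [this]
    exact (measurableSet_lt measurable_const measurable_snd).inter (measurableSet_lt measurable_snd measurable_fst.fst)
  set F : (ℝ × EuclideanSpace ℝ (Fin 3)) × ℝ → ℝ := fun q =>
    {q : (ℝ × EuclideanSpace ℝ (Fin 3)) × ℝ | q.2 ∈ Ioo 0 q.1.1}.indicator
      (fun q => UnboundedOperators.heatExtension (g q.2) (q.1.1 - q.2) q.1.2) q with hF
  have hFm : Measurable F := hH.indicator hS
  have e : (uncurry fun t x => ∫ s in Ioo 0 t, UnboundedOperators.heatExtension (g s) (t - s) x) =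
      fun w : ℝ × EuclideanSpace ℝ (Fin 3) => ∫ s, F (w, s) := by
    funext w
    simp only [uncurry]
    rw [← integral_indicator measurableSet_Ioo]
    refine integral_congr_ae (Eventually.of_forall fun s => ?_)
    simp only [hF, indicator, mem_setOf_eq]
  rw [e]
  exact hFm.stronglyMeasurable.integral_prod_right'

/-! ## Directional derivatives of `C^{m+1}` functions -/

/-- `‖Dᵐ(y ↦ Df(y)v)(x)‖ ≤ ‖v‖ ‖Dᵐ⁺¹f(x)‖` for `f ∈ C^{m+1}`. [folklore] -/
theorem norm_iteratedFDeriv_fderiv_apply_le {F : Type*} [NormedAddCommGroup F] [NormedSpace ℝ F]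
    {f : (EuclideanSpace ℝ (Fin 3)) → F} {m : ℕ} (hf : ContDiff ℝ (m + 1) f) (v x : EuclideanSpace ℝ (Fin 3)) :
    ‖iteratedFDeriv ℝ m (fun y => fderiv ℝ f y v) x‖ ≤ ‖v‖ * ‖iteratedFDeriv ℝ (m + 1) f x‖ := by
  have hfd : ContDiff ℝ m (fderiv ℝ f) := hf.fderiv_right (m := m) (by norm_cast)
  have e : (fun y => fderiv ℝ f y v) = (ContinuousLinearMap.apply ℝ F v) ∘ fderiv ℝ f := rfl
  rw [e, ContinuousLinearMap.iteratedFDeriv_comp_left _ hfd.contDiffAt (by exact_mod_cast le_rfl),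
    ← norm_iteratedFDeriv_fderiv]
  have hA : ‖ContinuousLinearMap.apply ℝ F v‖ ≤ ‖v‖ :=
    ContinuousLinearMap.opNorm_le_bound _ (norm_nonneg _) fun A => by
      rw [ContinuousLinearMap.apply_apply, mul_comm]; exact A.le_opNorm v
  exact (ContinuousLinearMap.norm_compContinuousMultilinearMap_le _ _).trans
    (mul_le_mul_of_nonneg_right hA (norm_nonneg _))

/-- `Dᵐ(y ↦ Df(y)v)(x) - Dᵐ(y ↦ Dg(y)v)(x')` is bounded by `‖v‖ ‖Dᵐ⁺¹f(x) - Dᵐ⁺¹g(x')‖`, for the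
same function: `‖Dᵐ(∂ᵥf)(x) - Dᵐ(∂ᵥf)(x')‖ ≤ ‖v‖ ‖Dᵐ⁺¹f(x) - Dᵐ⁺¹f(x')‖`. [folklore] -/
theorem norm_iteratedFDeriv_fderiv_apply_sub_le {F : Type*} [NormedAddCommGroup F] [NormedSpace ℝ F]
    {f : (EuclideanSpace ℝ (Fin 3)) → F} {m : ℕ} (hf : ContDiff ℝ (m + 1) f) (v x x' : EuclideanSpace ℝ (Fin 3)) :
    ‖iteratedFDeriv ℝ m (fun y => fderiv ℝ f y v) x - iteratedFDeriv ℝ m (fun y => fderiv ℝ f y v) x'‖ ≤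
      ‖v‖ * ‖iteratedFDeriv ℝ (m + 1) f x - iteratedFDeriv ℝ (m + 1) f x'‖ := by
  have hfd : ContDiff ℝ m (fderiv ℝ f) := hf.fderiv_right (m := m) (by norm_cast)
  have e : (fun y => fderiv ℝ f y v) = (ContinuousLinearMap.apply ℝ F v) ∘ fderiv ℝ f := rfl
  rw [e, ContinuousLinearMap.iteratedFDeriv_comp_left _ hfd.contDiffAt (by exact_mod_cast le_rfl),
    ContinuousLinearMap.iteratedFDeriv_comp_left _ hfd.contDiffAt (by exact_mod_cast le_rfl)]
  -- `Dᵐ⁺¹ f = R ∘ Dᵐ(Df)` with a linear isometry `R`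
  have hR : ∀ y, ‖iteratedFDeriv ℝ m (fderiv ℝ f) y - iteratedFDeriv ℝ m (fderiv ℝ f) x'‖ =
      ‖iteratedFDeriv ℝ (m + 1) f y - iteratedFDeriv ℝ (m + 1) f x'‖ := by
    intro y
    rw [iteratedFDeriv_succ_eq_comp_right, iteratedFDeriv_succ_eq_comp_right, Function.comp_apply, Function.comp_apply,
      ← map_sub, LinearIsometryEquiv.norm_map]
  rw [← hR x]
  have hlin : (ContinuousLinearMap.apply ℝ F v).compContinuousMultilinearMap (iteratedFDeriv ℝ m (fderiv ℝ f) x) -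
      (ContinuousLinearMap.apply ℝ F v).compContinuousMultilinearMap (iteratedFDeriv ℝ m (fderiv ℝ f) x') =
      (ContinuousLinearMap.apply ℝ F v).compContinuousMultilinearMap
        (iteratedFDeriv ℝ m (fderiv ℝ f) x - iteratedFDeriv ℝ m (fderiv ℝ f) x') := by
    ext w; simp
  rw [hlin]
  have hA : ‖ContinuousLinearMap.apply ℝ F v‖ ≤ ‖v‖ :=
    ContinuousLinearMap.opNorm_le_bound _ (norm_nonneg _) fun A => by
      rw [ContinuousLinearMap.apply_apply, mul_comm]; exact A.le_opNorm v
  exact (ContinuousLinearMap.norm_compContinuousMultilinearMap_le _ _).trans (mul_le_mul_of_nonneg_right hA (norm_nonneg _))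

/-! ## Measurability of heat potentials as functions on space–time -/

/-- The forward heat potential of measurable data is measurable on `ℝ × ℝ³`. [folklore] -/
theorem measurable_heatPotential {D : ℝ × (EuclideanSpace ℝ (Fin 3)) → ℝ} (hDm : Measurable D) :
    Measurable (heatPotential 1 D) := by
  have hI : Measurable fun p : (ℝ × EuclideanSpace ℝ (Fin 3)) × (ℝ × EuclideanSpace ℝ (Fin 3)) =>
      heatKernelFwd 1 (p.1 - p.2) • D p.2 :=
    (measurable_heatKernelFwd_one.comp (measurable_fst.sub measurable_snd)).smul (hDm.comp measurable_snd)
  have e : heatPotential 1 D = fun w => ∫ w', (fun p : (ℝ × EuclideanSpace ℝ (Fin 3)) × (ℝ × EuclideanSpace ℝ (Fin 3)) =>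
      heatKernelFwd 1 (p.1 - p.2) • D p.2) (w, w') := by
    funext w; rfl
  rw [e]
  exact (hI.stronglyMeasurable.integral_prod_right').measurable

/-! ## Globalisation of a datum smooth on a ball by a cut-off -/

/-- **A cut-off times a function smooth on a ball is globally smooth with controlled derivatives.**
If `u₀` is `C^∞` on `B(x₀, 1)` with `‖Dᵏu₀‖ ≤ A k` there, and `χ ∈ C^∞` has `tsupport χ ⊆ B̄(x₀, r)`
with `r < 1` and `‖Dᵏχ‖ ≤ X k`, then for every direction `c` the real function `χ ⟪u₀, c⟫` is `Cᵐ`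
for every `m`, with `‖Dᵐ(χ⟪u₀,c⟫)‖ ≤ ‖c‖ Σ_{i≤m} (m choose i) X i A (m - i)` (Leibniz within the
ball; zero outside). [folklore] -/
theorem smooth_cutoff_datum {u₀ : (EuclideanSpace ℝ (Fin 3)) → (EuclideanSpace ℝ (Fin 3))} {x₀ : EuclideanSpace ℝ (Fin 3)}
    (hu₀ : ContDiffOn ℝ (⊤ : ℕ∞) u₀ (ball x₀ 1)) {A : ℕ → ℝ}
    (hA : ∀ k, ∀ x ∈ ball x₀ 1, ‖iteratedFDeriv ℝ k u₀ x‖ ≤ A k)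
    {χ : (EuclideanSpace ℝ (Fin 3)) → ℝ} (hχ : ContDiff ℝ (⊤ : ℕ∞) χ) {r : ℝ} (hr : r < 1)
    (hχs : tsupport χ ⊆ closedBall x₀ r) {X : ℕ → ℝ} (hX0 : ∀ k, 0 ≤ X k) (hX : ∀ k x, ‖iteratedFDeriv ℝ k χ x‖ ≤ X k)
    (hA0 : ∀ k, 0 ≤ A k) (c : EuclideanSpace ℝ (Fin 3)) :
    (∀ m : ℕ, ContDiff ℝ m (fun y => χ y * ⟪u₀ y, c⟫_ℝ)) ∧
    ∀ (m : ℕ) (x : EuclideanSpace ℝ (Fin 3)), ‖iteratedFDeriv ℝ m (fun y => χ y * ⟪u₀ y, c⟫_ℝ) x‖ ≤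
      ‖c‖ * ∑ i ∈ Finset.range (m + 1), (m.choose i : ℝ) * X i * A (m - i) := by
  -- the scalar datum `⟪u₀, c⟫` on the ball
  set w : (EuclideanSpace ℝ (Fin 3)) → ℝ := fun y => ⟪u₀ y, c⟫_ℝ with hw
  have hwU : ContDiffOn ℝ (⊤ : ℕ∞) w (ball x₀ 1) := hu₀.inner (𝕜 := ℝ) contDiffOn_const
  have hU : IsOpen (ball x₀ (1 : ℝ)) := isOpen_ball
  -- the product vanishes near every point off the ball
  set f : (EuclideanSpace ℝ (Fin 3)) → ℝ := fun y => χ y * w y with hf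
  have hfU : ContDiffOn ℝ (⊤ : ℕ∞) f (ball x₀ 1) := hχ.contDiffOn.mul hwU
  have hχ0 : ∀ y, y ∉ closedBall x₀ r → χ =ᶠ[𝓝 y] fun _ => 0 := fun y hy =>
    notMem_tsupport_iff_eventuallyEq.1 fun h => hy (hχs h)
  have hf0 : ∀ y, y ∉ closedBall x₀ r → f =ᶠ[𝓝 y] fun _ => 0 := fun y hy =>
    (hχ0 y hy).mono fun z hz => by simp only [hf, hz, zero_mul]
  have hcb : closedBall x₀ r ⊆ ball x₀ 1 := closedBall_subset_ball hr
  have hfs : ∀ m : ℕ, ContDiff ℝ m f := by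
    intro m
    refine contDiff_iff_contDiffAt.2 fun y => ?_
    by_cases hy : y ∈ closedBall x₀ r
    · exact ((hfU.of_le (by exact_mod_cast le_top)).contDiffAt (hU.mem_nhds (hcb hy)))
    · exact (contDiffAt_const (c := (0 : ℝ))).congr_of_eventuallyEq (hf0 y hy)
  refine ⟨hfs, fun m x => ?_⟩
  have hsum0 : 0 ≤ ‖c‖ * ∑ i ∈ Finset.range (m + 1), (m.choose i : ℝ) * X i * A (m - i) :=
    mul_nonneg (norm_nonneg _) (Finset.sum_nonneg fun i _ => by
      have := hX0 i; have := hA0 (m - i); positivity)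
  by_cases hx : x ∈ closedBall x₀ r
  · have hxU : x ∈ ball x₀ 1 := hcb hx
    -- Leibniz within the ball
    rw [← iteratedFDerivWithin_of_isOpen m hU hxU]
    have hB := ContinuousLinearMap.norm_iteratedFDerivWithin_le_of_bilinear (ContinuousLinearMap.mul ℝ ℝ)
      (hχ.contDiffOn.of_le (by exact_mod_cast le_top) : ContDiffOn ℝ m χ (ball x₀ 1))
      (hwU.of_le (by exact_mod_cast le_top) : ContDiffOn ℝ m w (ball x₀ 1)) hU.uniqueDiffOn hxU
      (n := m) (by exact_mod_cast le_rfl)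
    have e1 : (fun y => (ContinuousLinearMap.mul ℝ ℝ) (χ y) (w y)) = f := by
      funext y; simp [hf]
    rw [e1] at hB
    refine hB.trans ?_
    have hmul : ‖ContinuousLinearMap.mul ℝ ℝ‖ ≤ 1 := ContinuousLinearMap.opNorm_mul_le ℝ ℝ
    -- bounds of the factors within the ball
    have hχi : ∀ i, ‖iteratedFDerivWithin ℝ i χ (ball x₀ 1) x‖ ≤ X i := fun i => by
      rw [iteratedFDerivWithin_of_isOpen i hU hxU]; exact hX i x
    have hwi : ∀ i, ‖iteratedFDerivWithin ℝ i w (ball x₀ 1) x‖ ≤ ‖c‖ * A i := by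
      intro i
      rw [iteratedFDerivWithin_of_isOpen i hU hxU]
      -- `w = (innerSL flipped) ∘ u₀` near `x`
      have hloc : w =ᶠ[𝓝 x] fun y => (innerSL ℝ c : EuclideanSpace ℝ (Fin 3) →L[ℝ] ℝ) (u₀ y) := by
        refine Eventually.of_forall fun y => ?_
        simp only [hw, innerSL_apply_apply, real_inner_comm]
      rw [(hloc.iteratedFDeriv (𝕜 := ℝ) i).eq_of_nhds]
      have hcd : ContDiffAt ℝ i u₀ x := (hu₀.of_le (by exact_mod_cast le_top)).contDiffAt (hU.mem_nhds hxU)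
      rw [show (fun y => (innerSL ℝ c : EuclideanSpace ℝ (Fin 3) →L[ℝ] ℝ) (u₀ y)) =
        (innerSL ℝ c : EuclideanSpace ℝ (Fin 3) →L[ℝ] ℝ) ∘ u₀ from rfl,
        ContinuousLinearMap.iteratedFDeriv_comp_left _ hcd (by exact_mod_cast le_rfl)]
      refine (ContinuousLinearMap.norm_compContinuousMultilinearMap_le _ _).trans ?_
      exact mul_le_mul (by rw [innerSL_apply_norm]) (hA i x hxU) (norm_nonneg _) (norm_nonneg _)
    calc ‖ContinuousLinearMap.mul ℝ ℝ‖ * ∑ i ∈ Finset.range (m + 1), (m.choose i : ℝ) *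
          ‖iteratedFDerivWithin ℝ i χ (ball x₀ 1) x‖ * ‖iteratedFDerivWithin ℝ (m - i) w (ball x₀ 1) x‖
        ≤ 1 * ∑ i ∈ Finset.range (m + 1), (m.choose i : ℝ) * X i * (‖c‖ * A (m - i)) := by
          refine mul_le_mul hmul (Finset.sum_le_sum fun i _ => ?_) (Finset.sum_nonneg fun i _ => by positivity) zero_le_one
          exact mul_le_mul (mul_le_mul_of_nonneg_left (hχi i) (by positivity)) (hwi (m - i)) (norm_nonneg _)
            (mul_nonneg (by positivity) (hX0 i))
      _ = ‖c‖ * ∑ i ∈ Finset.range (m + 1), (m.choose i : ℝ) * X i * A (m - i) := by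
          rw [one_mul, Finset.mul_sum]
          refine Finset.sum_congr rfl fun i _ => by ring
  · rw [((hf0 x hx).iteratedFDeriv (𝕜 := ℝ) m).eq_of_nhds]
    have : iteratedFDeriv ℝ m (fun _ : EuclideanSpace ℝ (Fin 3) => (0 : ℝ)) x = 0 := by
      rw [iteratedFDeriv_fun_zero]; rfl
    rw [this, norm_zero]
    exact hsum0

/-! ## The inner data of the bootstrap: `χ Rᵥ R_c` is `C^{n,γ}` with universal bounds -/

/-- Components of a `C^{n,γ}` field are `C^{n,γ}` functions with the same bounds (for unit
directions). [folklore] -/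
theorem component_level {n : ℕ} {R : (EuclideanSpace ℝ (Fin 3)) → (EuclideanSpace ℝ (Fin 3))} {𝒞 γ : ℝ}
    (hRn : ContDiff ℝ n R) (hRb : ∀ k ≤ n, ∀ x, ‖iteratedFDeriv ℝ k R x‖ ≤ 𝒞)
    (hRH : ∀ x y, ‖iteratedFDeriv ℝ n R x - iteratedFDeriv ℝ n R y‖ ≤ 𝒞 * ‖x - y‖ ^ γ)
    {v : EuclideanSpace ℝ (Fin 3)} (hv : ‖v‖ ≤ 1) :
    ContDiff ℝ n (fun y => ⟪R y, v⟫_ℝ) ∧ (∀ k ≤ n, ∀ x, ‖iteratedFDeriv ℝ k (fun y => ⟪R y, v⟫_ℝ) x‖ ≤ 𝒞) ∧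
      ∀ x y, ‖iteratedFDeriv ℝ n (fun y => ⟪R y, v⟫_ℝ) x - iteratedFDeriv ℝ n (fun y => ⟪R y, v⟫_ℝ) y‖ ≤ 𝒞 * ‖x - y‖ ^ γ := by
  set L : (EuclideanSpace ℝ (Fin 3)) →L[ℝ] ℝ := innerSL ℝ v with hL
  have hLn : ‖L‖ ≤ 1 := by rw [hL, innerSL_apply_norm]; exact hv
  have e : (fun y => ⟪R y, v⟫_ℝ) = L ∘ R := by
    funext y; simp only [hL, Function.comp_apply, innerSL_apply_apply, real_inner_comm]
  have h𝒞 : 0 ≤ 𝒞 := (norm_nonneg _).trans (hRb 0 (Nat.zero_le _) 0)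
  rw [e]
  refine ⟨L.contDiff.comp hRn, fun k hk x => ?_, fun x y => ?_⟩
  · rw [L.iteratedFDeriv_comp_left hRn.contDiffAt (by exact_mod_cast hk)]
    calc _ ≤ ‖L‖ * ‖iteratedFDeriv ℝ k R x‖ := L.norm_compContinuousMultilinearMap_le _
      _ ≤ 1 * 𝒞 := mul_le_mul hLn (hRb k hk x) (norm_nonneg _) zero_le_one
      _ = 𝒞 := one_mul _
  · rw [L.iteratedFDeriv_comp_left hRn.contDiffAt (by exact_mod_cast le_rfl),
      L.iteratedFDeriv_comp_left hRn.contDiffAt (by exact_mod_cast le_rfl)]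
    have hlin : L.compContinuousMultilinearMap (iteratedFDeriv ℝ n R x) - L.compContinuousMultilinearMap (iteratedFDeriv ℝ n R y) =
        L.compContinuousMultilinearMap (iteratedFDeriv ℝ n R x - iteratedFDeriv ℝ n R y) := by
      ext w; simp
    rw [hlin]
    calc _ ≤ ‖L‖ * ‖iteratedFDeriv ℝ n R x - iteratedFDeriv ℝ n R y‖ := L.norm_compContinuousMultilinearMap_le _
      _ ≤ 1 * (𝒞 * ‖x - y‖ ^ γ) := mul_le_mul hLn (hRH x y) (norm_nonneg _) zero_le_one
      _ = _ := one_mul _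

/-- **The inner data are `C^{n,γ}` with universal bounds**: for `n` there is `K` with: if `R` is a
`C^{n,γ}` field with bounds `𝒞` and `χ ∈ C^{n+1}` with `‖Dᵏχ‖ ≤ X` (`k ≤ n + 1`), then for unit
directions `v, c` the function `χ ⟪R,v⟫ ⟪R,c⟫` is `Cⁿ` with `‖Dᵏ‖ ≤ K(2X + K𝒞²)²` (`k ≤ n`) and
`[Dⁿ]_γ ≤ K(2X + K𝒞²)²`. [folklore] -/
theorem exists_inner_data_bounds (n : ℕ) :
    ∃ K : ℝ, 0 ≤ K ∧ ∀ {R : (EuclideanSpace ℝ (Fin 3)) → (EuclideanSpace ℝ (Fin 3))} {χ : (EuclideanSpace ℝ (Fin 3)) → ℝ}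
      {𝒞 X γ : ℝ}, 0 < γ → γ ≤ 1 → 0 ≤ X →
      ContDiff ℝ n R → (∀ k ≤ n, ∀ x, ‖iteratedFDeriv ℝ k R x‖ ≤ 𝒞) →
      (∀ x y, ‖iteratedFDeriv ℝ n R x - iteratedFDeriv ℝ n R y‖ ≤ 𝒞 * ‖x - y‖ ^ γ) →
      ContDiff ℝ (n + 1) χ → (∀ k ≤ n + 1, ∀ x, ‖iteratedFDeriv ℝ k χ x‖ ≤ X) →
      ∀ {v c : EuclideanSpace ℝ (Fin 3)}, ‖v‖ ≤ 1 → ‖c‖ ≤ 1 →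
        ContDiff ℝ n (fun y => χ y * (⟪R y, v⟫_ℝ * ⟪R y, c⟫_ℝ)) ∧
        (∀ k ≤ n, ∀ x, ‖iteratedFDeriv ℝ k (fun y => χ y * (⟪R y, v⟫_ℝ * ⟪R y, c⟫_ℝ)) x‖ ≤ K * (2 * X + K * 𝒞 ^ 2) ^ 2) ∧
        ∀ x y, ‖iteratedFDeriv ℝ n (fun y => χ y * (⟪R y, v⟫_ℝ * ⟪R y, c⟫_ℝ)) x -
          iteratedFDeriv ℝ n (fun y => χ y * (⟪R y, v⟫_ℝ * ⟪R y, c⟫_ℝ)) y‖ ≤ K * (2 * X + K * 𝒞 ^ 2) ^ 2 * ‖x - y‖ ^ γ := by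
  obtain ⟨K, hK0, hK⟩ := HolderLeibniz.exists_leibniz_holder (E := EuclideanSpace ℝ (Fin 3)) n
  refine ⟨K, hK0, ?_⟩
  intro R χ 𝒞 X γ hγ0 hγ1 hX0 hRn hRb hRH hχ hχb v c hv hc
  have h𝒞 : 0 ≤ 𝒞 := (norm_nonneg _).trans (hRb 0 (Nat.zero_le _) 0)
  set B : ℝ →L[ℝ] ℝ →L[ℝ] ℝ := ContinuousLinearMap.mul ℝ ℝ with hB
  have hBn : ‖B‖ ≤ 1 := ContinuousLinearMap.opNorm_mul_le ℝ ℝ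
  -- the components
  obtain ⟨hv1, hv2, hv3⟩ := component_level hRn hRb hRH hv
  obtain ⟨hc1, hc2, hc3⟩ := component_level hRn hRb hRH hc
  -- first product `⟪R,v⟫ ⟪R,c⟫`
  obtain ⟨hP1, hP2⟩ := hK B hγ0 hγ1 h𝒞 hv1 hc1 hv2 hc2 hv3 hc3
  have hPc : ContDiff ℝ n (fun y => ⟪R y, v⟫_ℝ * ⟪R y, c⟫_ℝ) := hv1.mul hc1
  have eP : (fun y => B (⟪R y, v⟫_ℝ) (⟪R y, c⟫_ℝ)) = fun y => ⟪R y, v⟫_ℝ * ⟪R y, c⟫_ℝ := by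
    funext y; simp [hB]
  rw [eP] at hP1 hP2
  have hM1 : K * ‖B‖ * 𝒞 ^ 2 ≤ K * 𝒞 ^ 2 := by
    calc K * ‖B‖ * 𝒞 ^ 2 ≤ K * 1 * 𝒞 ^ 2 := by gcongr
      _ = K * 𝒞 ^ 2 := by ring
  -- the cut-off as level-`n` data
  obtain ⟨hχn, hχb', hχH⟩ := HolderLeibniz.hyp_of_succ hχ hχb hγ0 hγ1
  -- common constant
  set M' : ℝ := 2 * X + K * 𝒞 ^ 2 with hM'
  have hXM : 2 * X ≤ M' := by rw [hM']; nlinarith [sq_nonneg 𝒞]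
  have hPM : K * 𝒞 ^ 2 ≤ M' := by rw [hM']; linarith
  have hM'0 : 0 ≤ M' := by rw [hM']; positivity
  obtain ⟨hQ1, hQ2⟩ := hK B hγ0 hγ1 hM'0 hχn hPc
    (fun k hk x => (hχb' k hk x).trans hXM) (fun k hk x => ((hP1 k hk x).trans hM1).trans hPM)
    (fun x y => (hχH x y).trans (mul_le_mul_of_nonneg_right hXM (Real.rpow_nonneg (norm_nonneg _) _)))
    (fun x y => (hP2 x y).trans (mul_le_mul_of_nonneg_right (hM1.trans hPM) (Real.rpow_nonneg (norm_nonneg _) _)))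
  have eQ : (fun y => B (χ y) (⟪R y, v⟫_ℝ * ⟪R y, c⟫_ℝ)) = fun y => χ y * (⟪R y, v⟫_ℝ * ⟪R y, c⟫_ℝ) := by
    funext y; simp [hB]
  rw [eQ] at hQ1 hQ2
  have hfin : K * ‖B‖ * M' ^ 2 ≤ K * M' ^ 2 := by
    calc K * ‖B‖ * M' ^ 2 ≤ K * 1 * M' ^ 2 := by gcongr
      _ = K * M' ^ 2 := by ring
  refine ⟨hχn.mul hPc, fun k hk x => (hQ1 k hk x).trans hfin, fun x y =>
    (hQ2 x y).trans (mul_le_mul_of_nonneg_right hfin (Real.rpow_nonneg (norm_nonneg _) _))⟩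

end JiaSverak2014

end Literature.Analysis.FluidPDE
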